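import Summits.QuantumFields.YangMills.Theorems.ColdStartUniversalityLatticeLangevinMeanLinkTraceMoments
import HarnessLib

/-!
# Route `ColdStartUniversality` (fixed-cut-off package): the `O(log L)` cold-start mixing time for GENERAL bounded observables is SHARP —
# a `log L − O(1)` LOWER bound at `β' = 0` (second-moment method on the mean link trace)

Helper file (seat `ym-line-csu-p1`, g28; `--supports stmt-QuantumFields-24809`), sequel of `…MeanLinkTraceMoments`.  g27: every bounded observable of the
SU(2) SZZ dynamics on `(ℤ/L)³` is within `ε` of its `μ_(β')`-mean after `2 + log(√(2B_L)/ε)/(1−12|β'|) = O(log L)` lattice time units (`|β'| < 1/12`);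
g28: macroscopic (smooth, spatially averaged) observables need only `O(log(1/ε))`.  Here the first statement is shown to be SHARP already at `β' = 0`
(product Brownian motion on `SU(2)^E`, invariant measure `μ_0 = Haar^(⊗E)`), with the mean link trace `G = (#E)⁻¹ Σ_e Re tr U_e`:
* ★★★ `wilson_coldStart_mixing_lower_bound_beta_zero` — for EVERY cold-start solution at `β' = 0` and every lattice time `t` with `16·e^(3t) ≤ #E`
  (`#E = 3L³`) the indicator `g` of `{G ≥ e^(−3t/2)}` (measurable, `|g| ≤ 1`) has `E g(U_t) − ∫ g dμ_0 ≥ 1/2`;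
* ★★★ `wilson_coldStart_mixingTime_ge_log_beta_zero` — hence for `t ≤ (1/3)·log(3L³/16) = log L − (1/3)log(16/3)` the law of `U_t` is at total-variation
  distance `≥ 1/2` from `μ_0`: the `½`-mixing time of bounded observables is `≥ log L − 0.56` lattice units, `Θ(log L)` together with g27's upper bound.
DICHOTOMY (fixed cut-off, lattice units): general bounded observables `Θ(log L)`; macroscopic observables `O(1)` (`…MacroscopicMixing`).  In the crux's
PHYSICAL time `ε_K·log L_K → 0`, so this is NO obstruction to `UniformColdStartMixing`; it says which fixed-cut-off statements can be volume-uniform.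
Ingredients: `wilson_coldStart_meanLinkTrace_moments_beta_zero` (`E G(U_t) = 2e^(−3t/2)`, `E(G(U_t) − 2e^(−3t/2))² ≤ 4/#E`), `integral_meanLinkTrace_sq_pi_haar_le`,
`exists_regularFlow` + `lawUnique_of_start` (transfer to an arbitrary solution), `wilsonMeasure_zero_eq_pi`, Chebyshev by hand.  THEOREMS ONLY, no definition,
no sorry.  HONEST FRAMING: fixed cut-off, `β' = 0` only; nothing K-uniform; 24809 ASIDE not restated; no crux, rung or summit statement is proved; the
Yang–Mills mass gap is NOT proved. [folklore]
-/

set_option autoImplicit false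

noncomputable section

namespace Summit.QuantumFields.YangMills.Theorems.ColdStartUniversality

open MeasureTheory ProbabilityTheory Finset
open scoped BigOperators NNReal ENNReal
open Literature.Probability.Process Literature.MathematicalPhysics.QuantumFieldTheory
open Literature.MathematicalPhysics.QuantumLattice (fundamentalRep fundamentalLatticeRep continuous_fundamentalRep)
open Literature.Analysis.SpecialFunctions (gegenbauerSum gegenbauerSum_one gegenbauerSum_zero)

variable {L : ℕ} [NeZero L]

/-! ## §4. The lower bound -/

/-- ★★★ **Total-variation LOWER bound for the cold-start `β' = 0` dynamics**: for every torus size `L`, EVERY solution of the SU(2) SZZ dynamics at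
`β' = 0` from the cold start `U ≡ 1` on any probability space, and every lattice time `t` with `16·e^(3t) ≤ #E` (`#E = 3L³`), the measurable
observable `g = 𝟙{(#E)⁻¹Σ_e Re tr U_e ≥ e^(−3t/2)}` (`|g| ≤ 1`) still separates the law of `U_t` from the invariant measure:
`E g(U_t) − ∫ g dμ_0 ≥ 1/2`.  (Second-moment method: `E G(U_t) = 2e^(−3t/2)`, both variances `≤ 4/#E`.) [folklore] -/
theorem wilson_coldStart_mixing_lower_bound_beta_zero (L : ℕ) [NeZero L]
    {Ω : Type} [MeasurableSpace Ω] {P : Measure Ω} [IsProbabilityMeasure P]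
    {W : ℝ≥0 → Ω → (Edge 3 L × NoiseIdx 2 → ℝ)} (hW : IsFlatBrownian W P)
    {U : ℝ≥0 → Ω → GaugeConfig 3 L (Matrix.specialUnitaryGroup (Fin 2) ℂ)} (hU0 : ∀ ω, U 0 ω = fun _ => 1)
    (hU : (latticeLangevinDynamics (fundamentalLatticeRep 2) 0).IsSolution (fundamentalRep (Fin 2)) hW.natFiltration P W U)
    (t : ℝ≥0) (h16 : 16 * Real.exp (3 * (t : ℝ)) ≤ (Fintype.card (Edge 3 L) : ℝ)) :
    ∃ g : GaugeConfig 3 L (Matrix.specialUnitaryGroup (Fin 2) ℂ) → ℝ, Measurable g ∧ (∀ V, |g V| ≤ 1) ∧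
      1 / 2 ≤ (∫ ω, g (U t ω) ∂P) - ∫ V, g V ∂(wilsonMeasure (d := 3) (L := L) (fundamentalRep (Fin 2)) 0) := by
  classical
  haveI := secondCountableTopology_su2
  haveI := borelSpace_config L
  haveI : IsProbabilityMeasure (haarProbability (Matrix.specialUnitaryGroup (Fin 2) ℂ)) := inferInstance
  have hnEpos : 0 < (Fintype.card (Edge 3 L) : ℝ) := by exact_mod_cast Fintype.card_pos
  set m : ℝ := 2 * Real.exp (-(3 / 2) * t) with hm
  set Gf : GaugeConfig 3 L (Matrix.specialUnitaryGroup (Fin 2) ℂ) → ℝ := fun V => (((Fintype.card (Edge 3 L) : ℝ))⁻¹ * ∑ e, gegenbauerSum 1 1 (hsForm 2 (fundamentalRep (Fin 2) 1) (fundamentalRep (Fin 2) (V e)) / 2)) with hGf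
  have hGc : Continuous Gf := continuous_const.mul (continuous_finsetSum _ fun e _ => continuous_linkTrace e)
  set g : GaugeConfig 3 L (Matrix.specialUnitaryGroup (Fin 2) ℂ) → ℝ := fun V => if Real.exp (-(3 / 2) * t) ≤ Gf V then 1 else 0 with hg
  have hgm : Measurable g := Measurable.ite (measurableSet_le measurable_const hGc.measurable) measurable_const measurable_const
  have hgb : ∀ V, |g V| ≤ 1 := fun V => by
    simp only [hg]; split_ifs <;> norm_num
  refine ⟨g, hgm, hgb, ?_⟩
  -- the regular flow and the transfer of the law
  obtain ⟨Φ, -, hΦ, hΦm, -, -, -⟩ := exists_regularFlow L 0 hW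
  have hlaw : P.map (U t) = P.map (Φ (fun _ => 1) t) :=
    lawUnique_of_start 0 (fun _ => 1) hW hW hU0 hU (hΦ (fun _ => 1)).1 (hΦ (fun _ => 1)).2 t
  have hmU : Measurable (U t) := (hU.adapted t).mono (hW.natFiltration.le t) le_rfl
  have hmΦ : Measurable (Φ (fun _ => 1) t) := ((hΦ (fun _ => 1)).2.adapted t).mono (hW.natFiltration.le t) le_rfl
  have htransfer : ∫ ω, g (U t ω) ∂P = ∫ ω, g (Φ (fun _ => 1) t ω) ∂P := by
    rw [← integral_map hmU.aemeasurable hgm.aestronglyMeasurable, hlaw, integral_map hmΦ.aemeasurable hgm.aestronglyMeasurable]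
  rw [htransfer, wilsonMeasure_zero_eq_pi]
  -- moments along the flow and under Haar
  obtain ⟨-, hVar⟩ := wilson_coldStart_meanLinkTrace_moments_beta_zero hW Φ hΦ hΦm t
  have hHaar := integral_meanLinkTrace_sq_pi_haar_le (L := L)
  set π : Measure (GaugeConfig 3 L (Matrix.specialUnitaryGroup (Fin 2) ℂ)) := Measure.pi fun _ : Edge 3 L => haarProbability (Matrix.specialUnitaryGroup (Fin 2) ℂ) with hπ
  haveI : IsProbabilityMeasure π := by rw [hπ]; infer_instance
  have hexp3 : Real.exp (3 * (t : ℝ)) * Real.exp (-(3 / 2) * t) ^ 2 = 1 := by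
    rw [sq, ← Real.exp_add, ← Real.exp_add]; ring_nf; exact Real.exp_zero
  have hexp_pos : 0 < Real.exp (3 * (t : ℝ)) := Real.exp_pos _
  -- pointwise comparisons
  have hlow : ∀ V, 1 - g V ≤ Real.exp (3 * (t : ℝ)) * (Gf V - m) ^ 2 := by
    intro V
    simp only [hg]
    split_ifs with hle
    · have : 0 ≤ Real.exp (3 * (t : ℝ)) * (Gf V - m) ^ 2 := by positivity
      linarith
    · push Not at hle
      have hgap : Real.exp (-(3 / 2) * (t : ℝ)) ≤ m - Gf V := by rw [hm]; linarith
      have hpos : 0 ≤ Real.exp (-(3 / 2) * (t : ℝ)) := (Real.exp_pos _).le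
      have hsq : Real.exp (-(3 / 2) * (t : ℝ)) ^ 2 ≤ (Gf V - m) ^ 2 := by
        rw [show (Gf V - m) ^ 2 = (m - Gf V) ^ 2 by ring]
        exact pow_le_pow_left₀ hpos hgap 2
      calc (1 : ℝ) - 0 = Real.exp (3 * (t : ℝ)) * Real.exp (-(3 / 2) * t) ^ 2 := by rw [hexp3]; ring
        _ ≤ Real.exp (3 * (t : ℝ)) * (Gf V - m) ^ 2 := mul_le_mul_of_nonneg_left hsq hexp_pos.le
  have hup : ∀ V, g V ≤ Real.exp (3 * (t : ℝ)) * (Gf V) ^ 2 := by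
    intro V
    simp only [hg]
    split_ifs with hle
    · have hpos : 0 ≤ Real.exp (-(3 / 2) * (t : ℝ)) := (Real.exp_pos _).le
      have hsq : Real.exp (-(3 / 2) * (t : ℝ)) ^ 2 ≤ (Gf V) ^ 2 := pow_le_pow_left₀ hpos hle 2
      calc (1 : ℝ) = Real.exp (3 * (t : ℝ)) * Real.exp (-(3 / 2) * t) ^ 2 := hexp3.symm
        _ ≤ Real.exp (3 * (t : ℝ)) * (Gf V) ^ 2 := mul_le_mul_of_nonneg_left hsq hexp_pos.le
    · positivity
  -- integrate: along the flow
  have hGΦm : Measurable fun ω => Gf (Φ (fun _ => 1) t ω) := hGc.measurable.comp hmΦ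
  have hGb : ∀ V, |Gf V| ≤ 2 := fun V => abs_meanLinkTrace_le_two V
  have hsqi : Integrable (fun ω => Real.exp (3 * (t : ℝ)) * (Gf (Φ (fun _ => 1) t ω) - m) ^ 2) P := by
    refine Integrable.of_bound (((hGΦm.sub_const m).pow_const 2).const_mul _).aestronglyMeasurable (Real.exp (3 * (t : ℝ)) * (2 + |m|) ^ 2)
      (ae_of_all _ fun ω => ?_)
    rw [Real.norm_eq_abs, abs_mul, abs_of_pos hexp_pos, abs_pow]
    refine mul_le_mul_of_nonneg_left ?_ hexp_pos.le
    have h1 : |Gf (Φ (fun _ => 1) t ω) - m| ≤ 2 + |m| := (abs_sub _ _).trans (by linarith [hGb (Φ (fun _ => 1) t ω)])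
    exact pow_le_pow_left₀ (abs_nonneg _) h1 2
  have hgi : Integrable (fun ω => g (Φ (fun _ => 1) t ω)) P :=
    Integrable.of_bound (hgm.comp hmΦ).aestronglyMeasurable 1 (ae_of_all _ fun ω => by rw [Real.norm_eq_abs]; exact hgb _)
  have hflow : 1 - Real.exp (3 * (t : ℝ)) * (4 / (Fintype.card (Edge 3 L) : ℝ)) ≤ ∫ ω, g (Φ (fun _ => 1) t ω) ∂P := by
    have h1 : ∫ ω, (1 - g (Φ (fun _ => 1) t ω)) ∂P ≤ ∫ ω, Real.exp (3 * (t : ℝ)) * (Gf (Φ (fun _ => 1) t ω) - m) ^ 2 ∂P :=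
      integral_mono ((integrable_const _).sub hgi) hsqi fun ω => hlow _
    rw [integral_sub (integrable_const _) hgi, integral_const, smul_eq_mul, probReal_univ, one_mul, integral_const_mul] at h1
    have h2 := mul_le_mul_of_nonneg_left hVar hexp_pos.le
    linarith
  -- integrate: under Haar
  have hgiπ : Integrable g π := Integrable.of_bound hgm.aestronglyMeasurable 1 (ae_of_all _ fun V => by rw [Real.norm_eq_abs]; exact hgb _)
  have hsqπ : Integrable (fun V => Real.exp (3 * (t : ℝ)) * (Gf V) ^ 2) π :=
    (integrable_of_continuous_of_compactSpace (hGc.pow 2) _).const_mul _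
  have hhaar : ∫ V, g V ∂π ≤ Real.exp (3 * (t : ℝ)) * (4 / (Fintype.card (Edge 3 L) : ℝ)) := by
    have h1 : ∫ V, g V ∂π ≤ ∫ V, Real.exp (3 * (t : ℝ)) * (Gf V) ^ 2 ∂π := integral_mono hgiπ hsqπ fun V => hup V
    rw [integral_const_mul] at h1
    exact h1.trans (mul_le_mul_of_nonneg_left hHaar hexp_pos.le)
  -- conclude
  have hkey : Real.exp (3 * (t : ℝ)) * (4 / (Fintype.card (Edge 3 L) : ℝ)) ≤ 1 / 4 := by
    rw [mul_div_assoc', div_le_iff₀ hnEpos]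
    linarith
  linarith

/-- ★★★ **The cold-start mixing time is at least `log L − O(1)` at `β' = 0`.**  For every `L`, every cold-start solution of the SU(2) SZZ dynamics at
`β' = 0` and every lattice time `t ≤ (1/3)·log(3L³/16)` (`= log L − (1/3)log(16/3)`), some measurable observable `|g| ≤ 1` has
`E g(U_t) − ∫ g dμ_0 ≥ 1/2`: the `½`-mixing time of bounded observables is `≥ (1/3)log(3L³/16)` lattice units — g27's `O(log L)` upper bound
(`wilson_coldStart_mixingTime_log_volume`) is sharp up to constants, in contrast with the volume-independent equilibration of macroscopic observables
(`…MacroscopicMixing`). [folklore] -/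
theorem wilson_coldStart_mixingTime_ge_log_beta_zero (L : ℕ) [NeZero L]
    {Ω : Type} [MeasurableSpace Ω] {P : Measure Ω} [IsProbabilityMeasure P]
    {W : ℝ≥0 → Ω → (Edge 3 L × NoiseIdx 2 → ℝ)} (hW : IsFlatBrownian W P)
    {U : ℝ≥0 → Ω → GaugeConfig 3 L (Matrix.specialUnitaryGroup (Fin 2) ℂ)} (hU0 : ∀ ω, U 0 ω = fun _ => 1)
    (hU : (latticeLangevinDynamics (fundamentalLatticeRep 2) 0).IsSolution (fundamentalRep (Fin 2)) hW.natFiltration P W U)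
    (t : ℝ≥0) (ht : (t : ℝ) ≤ Real.log (3 * (L : ℝ) ^ 3 / 16) / 3) :
    ∃ g : GaugeConfig 3 L (Matrix.specialUnitaryGroup (Fin 2) ℂ) → ℝ, Measurable g ∧ (∀ V, |g V| ≤ 1) ∧
      1 / 2 ≤ (∫ ω, g (U t ω) ∂P) - ∫ V, g V ∂(wilsonMeasure (d := 3) (L := L) (fundamentalRep (Fin 2)) 0) := by
  refine wilson_coldStart_mixing_lower_bound_beta_zero L hW hU0 hU t ?_
  have hE : (Fintype.card (Edge 3 L) : ℝ) = 3 * (L : ℝ) ^ 3 := by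
    rw [Fintype.card_prod, card_site_three, Fintype.card_fin]; push_cast; ring
  have hL : (0 : ℝ) < 3 * (L : ℝ) ^ 3 := by
    have : 0 < L := Nat.pos_of_ne_zero (NeZero.ne L)
    positivity
  rw [hE]
  have h3 : 3 * (t : ℝ) ≤ Real.log (3 * (L : ℝ) ^ 3 / 16) := by linarith
  have h4 : Real.exp (3 * (t : ℝ)) ≤ 3 * (L : ℝ) ^ 3 / 16 := by
    calc Real.exp (3 * (t : ℝ)) ≤ Real.exp (Real.log (3 * (L : ℝ) ^ 3 / 16)) := Real.exp_le_exp.2 h3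
      _ = 3 * (L : ℝ) ^ 3 / 16 := Real.exp_log (by positivity)
  linarith

end Summit.QuantumFields.YangMills.Theorems.ColdStartUniversality
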